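import Literature.AnabelianGeometry.EtaleTheta.SettingModel2CoveringsStable
import Literature.AnabelianGeometry.EtaleTheta.SettingModelSemidirect
import HarnessLib

/-!
# A FINER model of the [EtTh] §1 root, part B4: the coverings `Π^tp_{Y_N} = Δ^tp_{Y_N} ⋊ B_N` in a twisted product `Γ ⋊_φ G`

Mochizuki, *The étale theta function …*, Publ. RIMS **45** (2009) [EtTh], §1, PRIMS PDF pp. 12–14
[cite: MochizukiEtTh2009, §1 p.13]: "`Π^tp_{Y_N}`", "`K_N := K(ζ_N, q_X^{1/N})`", "`Δ^tp_Y/Δ^tp_{Y_N} ≅ ℤ/Nℤ(1)`",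
"`Gal(Z_N/Y_N) ≅ ℤ/Nℤ(1)`". Layer L2 of the abc-iut cell, seat abc-iut-L2-t1 (root owner); prelude #3 of the χ-TWISTED root
model (abc-iut R78 reshape (B), file map R100, file F5), written for an ARBITRARY action `φ : G →* MulAut Γ` of a group `G`
on `Γ = F̂₂ ×_Ẑ ℤ` that preserves the degree and is read on each level `Γ → Heis(ℤ/N)` through `z`-axis-preserving maps
(`GfpTwistData φ` — the cyclotomic twist `θ_u : a ↦ a, b ↦ b^u` and its Tate variant `a ↦ a b^k` both qualify), so that it
does not wait for the twist's construction: the degree map `toZ : Γ ⋊_φ G ↠ ℤ` (a homomorphism because the degree is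
`φ`-invariant), the subgroups `YN N B := Δ^tp_{Y_N} ⋊ B`, `ZN N B := Δ^tp_{Z_N} ⋊ B` for `B ≤ G`, and the covering
clauses of the root `ThetaSetting` for them: `YN 1 ⊤ = Ker toZ`, `YN ≤ Ker toZ`, image `B` under `Γ ⋊ G ↠ G`, NORMALITY when
`B ⊴ G` acts trivially on the level (`χ ≡ 1 mod N` on `G_{K_N}`), openness, antitonicity, `ZN ≤ YN`, and the indices
`[Δ^tp_Y : Δ^tp_{Y_N}] = [Δ^tp_{Y_N} : Δ^tp_{Z_N}] = N` transferred along `inl`. F5 proper instantiates `G := G_{ℚ_p}`,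
`φ := twistGfp ∘ χ`, `B := G_{K_N}` / `G_{J_N}`. Model plumbing only; nothing of [EtTh] asserted; no side taken on
[IUTchIII] Cor. 3.12.
-/

noncomputable section

namespace Literature.AnabelianGeometry.EtaleTheta.SettingModel

open Literature.AnabelianGeometry.SemiGraphs
open Function

variable {G : Type*} [Group G]

/-- **Twist data** for an action `φ : G →* MulAut Γ`: `φ` preserves the degree `pr₂ : Γ → ℤ`, and on each level
`Γ → Heis(ℤ/N)` the automorphism `φ g` is read through a map `δ N g` of `Heis(ℤ/N)` preserving the `z`-axis and `1`
(for `θ_u`: `δ = (x,y,z) ↦ (x, uy, uz)`). [cite: MochizukiEtTh2009, §1 p.13] -/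
structure GfpTwistData (φ : G →* MulAut Gfp) where
  /-- `pr₂ ∘ φ_g = pr₂`. -/
  hdeg : ∀ (g : G) (γ : Gfp), gfpSnd (φ g γ) = gfpSnd γ
  /-- The level-`N` shadow of `φ g`. -/
  δ : ∀ (N : ℕ+), G → Heis (ZMod N) → Heis (ZMod N)
  /-- `δ` preserves the `z`-axis `{x = y = 0}`. -/
  δ_zAxis : ∀ (N : ℕ+) (g : G) ⦃h : Heis (ZMod N)⦄, h ∈ (Heis.zAxis : Subgroup (Heis (ZMod N))) →
    δ N g h ∈ (Heis.zAxis : Subgroup (Heis (ZMod N)))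
  /-- `δ 1 = 1`. -/
  δ_one : ∀ (N : ℕ+) (g : G), δ N g 1 = 1
  /-- `ĥ_N ∘ φ_g = δ_{N,g} ∘ ĥ_N`. -/
  hlev : ∀ (N : ℕ+) (g : G) (γ : Gfp), levelHom N (φ g γ) = δ N g (levelHom N γ)

namespace GfpTwistData

variable {φ : G →* MulAut Gfp}

/-- `Δ^tp_{Y_N}` is `φ(G)`-stable. [cite: MochizukiEtTh2009, §1 p.13] -/
theorem act_mem_dY (T : GfpTwistData φ) (N : ℕ+) (g : G) ⦃γ : Gfp⦄ (hγ : γ ∈ dY N) : φ g γ ∈ dY N :=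
  map_mem_dY (φ g).toMonoidHom (T.hdeg g) (T.δ N g) (T.δ_zAxis N g) (T.hlev N g) hγ

/-- `Δ^tp_{Z_N}` is `φ(G)`-stable. [cite: MochizukiEtTh2009, §1 p.14] -/
theorem act_mem_dZ (T : GfpTwistData φ) (N : ℕ+) (g : G) ⦃γ : Gfp⦄ (hγ : γ ∈ dZ N) : φ g γ ∈ dZ N :=
  map_mem_dZ (φ g).toMonoidHom (T.hdeg g) (T.δ N g) (T.δ_one N g) (T.hlev N g) hγ

/-- **`Π^tp_X ↠ Z`** on `Γ ⋊_φ G`: `g ↦ pr₂(g.left)`. [cite: MochizukiEtTh2009, §1 p.12] -/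
def toZ (T : GfpTwistData φ) : Gfp ⋊[φ] G →* Multiplicative ℤ := Semidirect.leftHom gfpSnd T.hdeg

/-- [cite: MochizukiEtTh2009, §1 p.12] -/
theorem toZ_apply (T : GfpTwistData φ) (g : Gfp ⋊[φ] G) : T.toZ g = gfpSnd g.left := rfl

/-- [cite: MochizukiEtTh2009, §1 p.12] -/
theorem ker_toZ (T : GfpTwistData φ) : T.toZ.ker = Semidirect.twistedProd gfpSnd.ker ⊤ (Semidirect.stable_ker gfpSnd T.hdeg ⊤) :=
  Semidirect.ker_leftHom gfpSnd T.hdeg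

/-- [cite: MochizukiEtTh2009, §1 p.12] -/
theorem toZ_surjective (T : GfpTwistData φ) : Surjective T.toZ := Semidirect.leftHom_surjective gfpSnd T.hdeg gfpSnd_surjective

/-- `Δ^tp_X ↠ Z` is onto. [cite: MochizukiEtTh2009, §1 p.12] -/
theorem toZ_restrict_surjective (T : GfpTwistData φ) :
    Surjective (T.toZ.restrict (SemidirectProduct.rightHom : Gfp ⋊[φ] G →* G).ker) :=
  Semidirect.leftHom_restrict_ker_rightHom_surjective gfpSnd T.hdeg gfpSnd_surjective

/-- `Ker(Π^tp_X ↠ Z)` is open (when `g ↦ (g.left, g.right)` is continuous). [cite: MochizukiEtTh2009, §1 p.12] -/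
theorem isOpen_ker_toZ (T : GfpTwistData φ) [TopologicalSpace G] [TopologicalSpace (Gfp ⋊[φ] G)]
    (hc : Continuous fun g : Gfp ⋊[φ] G => (g.left, g.right)) : IsOpen (T.toZ.ker : Set (Gfp ⋊[φ] G)) := by
  rw [ker_toZ]
  exact Semidirect.isOpen_twistedProd hc isOpen_ker_gfpSnd isOpen_univ

/-- **`Π^tp_{Y_N} := Δ^tp_{Y_N} ⋊ B`** (`B = G_{K_N}`). [cite: MochizukiEtTh2009, §1 p.13] -/
def YN (T : GfpTwistData φ) (N : ℕ+) (B : Subgroup G) : Subgroup (Gfp ⋊[φ] G) :=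
  Semidirect.twistedProd (dY N) B (Semidirect.stable_of_forall (T.act_mem_dY N) B)

/-- **`Π^tp_{Z_N} := Δ^tp_{Z_N} ⋊ B`** (`B = G_{J_N}`). [cite: MochizukiEtTh2009, §1 p.14] -/
def ZN (T : GfpTwistData φ) (N : ℕ+) (B : Subgroup G) : Subgroup (Gfp ⋊[φ] G) :=
  Semidirect.twistedProd (dZ N) B (Semidirect.stable_of_forall (T.act_mem_dZ N) B)

/-- [cite: MochizukiEtTh2009, §1 p.13] -/
theorem mem_YN (T : GfpTwistData φ) {N : ℕ+} {B : Subgroup G} {g : Gfp ⋊[φ] G} : g ∈ T.YN N B ↔ g.left ∈ dY N ∧ g.right ∈ B := Iff.rfl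

/-- [cite: MochizukiEtTh2009, §1 p.14] -/
theorem mem_ZN (T : GfpTwistData φ) {N : ℕ+} {B : Subgroup G} {g : Gfp ⋊[φ] G} : g ∈ T.ZN N B ↔ g.left ∈ dZ N ∧ g.right ∈ B := Iff.rfl

/-- `Π^tp_{Y_1} = Π^tp_Y` (for `B = ⊤`, i.e. `K_1 = K`). [cite: MochizukiEtTh2009, §1 p.14] -/
theorem YN_one_top (T : GfpTwistData φ) : T.YN 1 ⊤ = T.toZ.ker := by
  rw [ker_toZ]
  exact Semidirect.twistedProd_eq_of_eq dY_one rfl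

/-- `Π^tp_{Y_N} ≤ Π^tp_Y`. [cite: MochizukiEtTh2009, §1 p.13] -/
theorem YN_le (T : GfpTwistData φ) (N : ℕ+) (B : Subgroup G) : T.YN N B ≤ T.toZ.ker := by
  rw [ker_toZ]
  exact Semidirect.twistedProd_mono (dY_le N) le_top

/-- `Π^tp_{Z_N} ≤ Π^tp_{Y_N}` (for `B' ≤ B`, i.e. `K_N ⊆ J_N`). [cite: MochizukiEtTh2009, §1 p.14] -/
theorem ZN_le_YN (T : GfpTwistData φ) (N : ℕ+) {B' B : Subgroup G} (h : B' ≤ B) : T.ZN N B' ≤ T.YN N B :=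
  Semidirect.twistedProd_mono (dZ_le_dY N) h

/-- [cite: MochizukiEtTh2009, §1 p.18] -/
theorem YN_anti (T : GfpTwistData φ) {M N : ℕ+} (h : (M : ℕ) ∣ N) {B_N B_M : Subgroup G} (hB : B_N ≤ B_M) : T.YN N B_N ≤ T.YN M B_M :=
  Semidirect.twistedProd_mono (dY_anti h) hB

/-- [cite: MochizukiEtTh2009, §1 p.18] -/
theorem ZN_anti (T : GfpTwistData φ) {M N : ℕ+} (h : (M : ℕ) ∣ N) {B_N B_M : Subgroup G} (hB : B_N ≤ B_M) : T.ZN N B_N ≤ T.ZN M B_M :=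
  Semidirect.twistedProd_mono (dZ_anti h) hB

/-- `Π^tp_{Y_N} ↠ G_{K_N}`. [cite: MochizukiEtTh2009, §1 p.13] -/
theorem map_rightHom_YN (T : GfpTwistData φ) (N : ℕ+) (B : Subgroup G) :
    (T.YN N B).map (SemidirectProduct.rightHom : Gfp ⋊[φ] G →* G) = B :=
  Semidirect.map_rightHom_twistedProd

/-- `Π^tp_{Z_N} ↠ G_{J_N}`. [cite: MochizukiEtTh2009, §1 p.14] -/
theorem map_rightHom_ZN (T : GfpTwistData φ) (N : ℕ+) (B : Subgroup G) :
    (T.ZN N B).map (SemidirectProduct.rightHom : Gfp ⋊[φ] G →* G) = B :=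
  Semidirect.map_rightHom_twistedProd

/-- **`Π^tp_{Y_N}` is normal** when `B ⊴ G` acts as the identity on the level-`N` Heisenberg group (`χ ≡ 1 mod N` on
`G_{K_N} ⊇ μ_N`-fixers). [cite: MochizukiEtTh2009, §1 p.14] -/
theorem YN_normal (T : GfpTwistData φ) (N : ℕ+) (B : Subgroup G) [B.Normal] (hB : ∀ ⦃b⦄, b ∈ B → ∀ h : Heis (ZMod N), T.δ N b h = h) :
    (T.YN N B).Normal := by
  haveI := dY_normal N
  refine Semidirect.twistedProd_normal (T.act_mem_dY N) ?_
  intro b hb γ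
  exact mul_inv_map_mem_dY (φ b).toMonoidHom (T.hdeg b)
    (fun γ => show levelHom N (φ b γ) = levelHom N γ by rw [T.hlev N b γ, hB hb]) γ

/-- **`Π^tp_{Z_N}` is normal** under the same condition on `B = G_{J_N}`. [cite: MochizukiEtTh2009, §1 p.14] -/
theorem ZN_normal (T : GfpTwistData φ) (N : ℕ+) (B : Subgroup G) [B.Normal] (hB : ∀ ⦃b⦄, b ∈ B → ∀ h : Heis (ZMod N), T.δ N b h = h) :
    (T.ZN N B).Normal := by
  haveI := dZ_normal N
  refine Semidirect.twistedProd_normal (T.act_mem_dZ N) ?_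
  intro b hb γ
  exact mul_inv_map_mem_dZ (φ b).toMonoidHom (T.hdeg b)
    (fun γ => show levelHom N (φ b γ) = levelHom N γ by rw [T.hlev N b γ, hB hb]) γ

/-- `Π^tp_{Y_N}` is open (for `B` open and `g ↦ (g.left, g.right)` continuous). [cite: MochizukiEtTh2009, §1 p.13] -/
theorem isOpen_YN (T : GfpTwistData φ) [TopologicalSpace G] [TopologicalSpace (Gfp ⋊[φ] G)]
    (hc : Continuous fun g : Gfp ⋊[φ] G => (g.left, g.right)) (N : ℕ+) {B : Subgroup G} (hB : IsOpen (B : Set G)) :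
    IsOpen (T.YN N B : Set (Gfp ⋊[φ] G)) :=
  Semidirect.isOpen_twistedProd hc (isOpen_dY N) hB

/-- `Π^tp_{Z_N}` is open. [cite: MochizukiEtTh2009, §1 p.14] -/
theorem isOpen_ZN (T : GfpTwistData φ) [TopologicalSpace G] [TopologicalSpace (Gfp ⋊[φ] G)]
    (hc : Continuous fun g : Gfp ⋊[φ] G => (g.left, g.right)) (N : ℕ+) {B : Subgroup G} (hB : IsOpen (B : Set G)) :
    IsOpen (T.ZN N B : Set (Gfp ⋊[φ] G)) :=
  Semidirect.isOpen_twistedProd hc (isOpen_dZ N) hB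

/-- `Δ^tp_{Y_N} = Π^tp_{Y_N} ∩ Δ^tp_X = Δ^tp_{Y_N} ⋊ 1`. [cite: MochizukiEtTh2009, §1 p.13] -/
theorem YN_inf_ker_rightHom (T : GfpTwistData φ) (N : ℕ+) (B : Subgroup G) :
    T.YN N B ⊓ (SemidirectProduct.rightHom : Gfp ⋊[φ] G →* G).ker =
      Semidirect.twistedProd (dY N) ⊥ (Semidirect.stable_bot (dY N)) :=
  Semidirect.twistedProd_inf_ker_rightHom

/-- `Δ^tp_{Z_N} = Π^tp_{Z_N} ∩ Δ^tp_X = Δ^tp_{Z_N} ⋊ 1`. [cite: MochizukiEtTh2009, §1 p.14] -/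
theorem ZN_inf_ker_rightHom (T : GfpTwistData φ) (N : ℕ+) (B : Subgroup G) :
    T.ZN N B ⊓ (SemidirectProduct.rightHom : Gfp ⋊[φ] G →* G).ker =
      Semidirect.twistedProd (dZ N) ⊥ (Semidirect.stable_bot (dZ N)) :=
  Semidirect.twistedProd_inf_ker_rightHom

/-- `Δ^tp_Y = Ker(Π^tp_X ↠ Z) ∩ Δ^tp_X = Ker pr₂ ⋊ 1`. [cite: MochizukiEtTh2009, §1 p.12] -/
theorem ker_toZ_inf_ker_rightHom (T : GfpTwistData φ) :
    T.toZ.ker ⊓ (SemidirectProduct.rightHom : Gfp ⋊[φ] G →* G).ker =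
      Semidirect.twistedProd gfpSnd.ker ⊥ (Semidirect.stable_bot gfpSnd.ker) := by
  rw [ker_toZ]
  exact Semidirect.twistedProd_inf_ker_rightHom

/-- **`[Δ^tp_Y : Δ^tp_{Y_N}] = N`** in `Γ ⋊_φ G`. [cite: MochizukiEtTh2009, §1 p.13] -/
theorem relIndex_YN (T : GfpTwistData φ) (N : ℕ+) (B : Subgroup G) :
    (T.YN N B ⊓ (SemidirectProduct.rightHom : Gfp ⋊[φ] G →* G).ker).relIndex
      (T.toZ.ker ⊓ (SemidirectProduct.rightHom : Gfp ⋊[φ] G →* G).ker) = N := by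
  rw [YN_inf_ker_rightHom, ker_toZ_inf_ker_rightHom, Semidirect.relIndex_twistedProd_bot φ, relIndex_dY]

/-- **`[Δ^tp_{Y_N} : Δ^tp_{Z_N}] = N`** in `Γ ⋊_φ G`. [cite: MochizukiEtTh2009, §1 p.14] -/
theorem relIndex_ZN (T : GfpTwistData φ) (N : ℕ+) (B' B : Subgroup G) :
    (T.ZN N B' ⊓ (SemidirectProduct.rightHom : Gfp ⋊[φ] G →* G).ker).relIndex
      (T.YN N B ⊓ (SemidirectProduct.rightHom : Gfp ⋊[φ] G →* G).ker) = N := by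
  rw [ZN_inf_ker_rightHom, YN_inf_ker_rightHom, Semidirect.relIndex_twistedProd_bot φ, relIndex_dZ]

/-- An element of `Π^tp_{Y_N}` whose `Γ`-component dies under the level-`N` map and whose `G`-component lies in `B'` is in
`Π^tp_{Z_N}` (the step `Ker(Π^tp_X ↠ (Π^tp_X)^Θ) ∩ Π^tp_{Y_N} ≤ Π^tp_{Z_N}` once `ĥ_N` kills `[[Δ̂,Δ̂],Δ̂]⁻`).
[cite: MochizukiEtTh2009, §1 p.14] -/
theorem mem_ZN_of_levelHom_eq_one (T : GfpTwistData φ) {N : ℕ+} {B B' : Subgroup G} {g : Gfp ⋊[φ] G} (hg : g ∈ T.YN N B)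
    (hlev : levelHom N g.left = 1) (hright : g.right ∈ B') : g ∈ T.ZN N B' :=
  ⟨Subgroup.mem_inf.mpr ⟨(Subgroup.mem_inf.mp hg.1).1, by rw [MonoidHom.mem_ker]; exact hlev⟩, hright⟩

end GfpTwistData

end Literature.AnabelianGeometry.EtaleTheta.SettingModel

end
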